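import Literature.RingTheory.SymmetricFunctions.CauchyIdentityAnalytic
import Literature.RepresentationTheory.FiniteGroups.SymmetricGroupFrobeniusOrthogonality
import HarnessLib

/-!
# Schur polynomials of a zero-padded alphabet and Cauchy's identity for alphabets of different sizes

Topic `Literature/RingTheory/SymmetricFunctions`; a PROOFS file (D-0014): theorems only.

For an alphabet `x = (x_1, …, x_b)` padded with `z` zeros, `x' = (x_1, …, x_b, 0, …, 0)`
(`Fin.append x 0 : Fin (b + z) → R`):

* `esymm_append_zero`: `e_r(x') = e_r(x)`;
* `schur_append_zero` (Macdonald 1995, Ch. I §3 (3.2): "`s_λ(x_1,…,x_n) = 0` unless `l(λ) ≤ n`",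
  and the stability `s_λ(x_1, …, x_b, 0, …, 0) = s_λ(x_1, …, x_b)`): for antitone
  `λ ∈ ℕ^{b+z}`, `s_λ(x') = s_{λ|_b}(x)` if `λ_{b+1} = ⋯ = λ_{b+z} = 0` and `0` otherwise. Since
  the tree's Schur polynomial is the Jacobi–Trudi determinant in exactly as many letters as parts,
  this is proved through **Shintani's uniqueness theorem** for the dual Pieri recursion
  (`eq_schur_smul_of_pieri`): the right-hand side, as a function of `λ`, satisfies
  `e_r(x') w(λ) = ∑_{#S = r} w(λ + 1_S)` by the dual Pieri rule in `b` letters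
  (`esymm_mul_schur`, `schur_addOn_eq_zero`) and `e_r(x') = e_r(x)`;
* `sum_piAntidiag_prod_pow_eq_sum_schur_mul_schur_append` — **Cauchy's identity for alphabets of
  sizes `b ≤ b + z`, degree by degree** (Macdonald 1995, Ch. I §4 (4.3)):
  `h_D(x ⊗ y) = ∑_{M : [b]×[b+z] → ℕ, |M| = D} ∏ (x_i y_j)^{M_{ij}} = ∑_{α ∈ ℕ^b antitone, |α| = D}
  s_α(x) s_{(α,0,…,0)}(y)` for `x ∈ R^b`, `y ∈ R^{b+z}`, from the square case
  (`cauchySeries_eq_prod_geom`) applied to `x'` and `y`.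

Used for the Kronecker coefficients of two rectangles of different heights
(Ikenmeyer–Panova 2017, Prop. 6.9) in `Literature/Computability/AlgebraicComplexity`.

## References

* [Macdonald1995] I. G. Macdonald, *Symmetric Functions and Hall Polynomials*, 2nd ed., Ch. I
  §3 (3.2), (3.4), §4 (4.3), §5 (5.17) (Pieri).
* [Miyauchi2014] M. Miyauchi, proof of Theorem 4 (Shintani's uniqueness argument), as used in
  `eq_schur_smul_of_pieri`.
-/

noncomputable section

open scoped BigOperators
open MvPolynomial Finset PowerSeries
open Literature.RepresentationTheory.FiniteGroups (coeff_prod_geom')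

namespace Literature.RingTheory.SymmetricFunctions.SymmPoly

variable {R : Type*} [CommRing R] {b z : ℕ}

/-! ### Weights vanishing beyond `b` -/

/-- A weight on `b + z` letters that vanishes on the last `z` letters and is antitone on the
first `b` letters is antitone. [folklore] -/
private theorem antitone_of_antitone_castAdd {μ : Fin (b + z) → ℕ} (h0 : ∀ j : Fin z, μ (Fin.natAdd b j) = 0)
    (hres : Antitone (fun i : Fin b => μ (Fin.castAdd z i))) : Antitone μ := by
  intro I J hIJ
  by_cases hJ : (J : ℕ) < b
  · have hI : (I : ℕ) < b := lt_of_le_of_lt hIJ hJ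
    have eI : Fin.castAdd z (Fin.castLT I hI) = I := Fin.castAdd_castLT z I hI
    have eJ : Fin.castAdd z (Fin.castLT J hJ) = J := Fin.castAdd_castLT z J hJ
    have := hres (show Fin.castLT I hI ≤ Fin.castLT J hJ from hIJ)
    dsimp only at this
    rwa [eI, eJ] at this
  · have hJ' : b ≤ (J : ℕ) := not_lt.mp hJ
    have eJ : Fin.natAdd b ⟨(J : ℕ) - b, by omega⟩ = J := by
      ext; simp; omega
    rw [← eJ, h0]
    exact Nat.zero_le _

/-- `(α, 0, …, 0)` is antitone when `α` is: a partition padded with a string of zeros at the end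
is the same partition (Macdonald 1995, Ch. I §1, after (1.1)). [cite: Macdonald1995, Ch. I §1 (1.1)] -/
theorem antitone_append_zero {α : Fin b → ℕ} (hα : Antitone α) (z : ℕ) :
    Antitone (Fin.append α (0 : Fin z → ℕ)) :=
  antitone_of_antitone_castAdd (fun j => by simp) (by simpa only [Fin.append_left] using hα)

/-- Restricting an antitone weight to the first `b` letters keeps it antitone. [folklore] -/
private theorem antitone_castAdd {μ : Fin (b + z) → ℕ} (hμ : Antitone μ) :
    Antitone (fun i : Fin b => μ (Fin.castAdd z i)) :=
  hμ.comp_monotone (Fin.strictMono_castAdd z).monotone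

/-- `|(α, 0, …, 0)| = |α|`. [folklore] -/
private theorem sum_append_zero (α : Fin b → ℕ) (z : ℕ) :
    ∑ i, Fin.append α (0 : Fin z → ℕ) i = ∑ i, α i := by
  rw [Fin.sum_univ_add]
  simp

/-- A weight vanishing beyond `b` is the zero-padding of its restriction. [folklore] -/
private theorem append_castAdd_eq {μ : Fin (b + z) → ℕ} (h0 : ∀ j : Fin z, μ (Fin.natAdd b j) = 0) :
    Fin.append (fun i : Fin b => μ (Fin.castAdd z i)) (0 : Fin z → ℕ) = μ := by
  refine funext (Fin.addCases (fun i => ?_) fun j => ?_)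
  · rw [Fin.append_left]
  · rw [Fin.append_right, h0]; rfl

/-! ### Elementary symmetric polynomials of a zero-padded alphabet -/

/-- `e_r(x) = (-1)^r [T^r] ∏_i (1 - x_i T)`. [folklore] -/
private theorem esymm_eq_coeff_eGen {n : ℕ} (x : Fin n → R) (r : ℕ) :
    esymm x r = (-1) ^ r * PowerSeries.coeff r (eGen univ x) := by
  rw [esymm, coeff_eGen, ← mul_assoc, ← pow_add, ← two_mul, pow_mul, neg_one_sq, one_pow,
    one_mul]

/-- `∏_{i ≤ b+z} (1 - x'_i T) = ∏_{i ≤ b} (1 - x_i T)` for the zero-padded alphabet. [folklore] -/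
private theorem eGen_append_zero (x : Fin b → R) :
    eGen univ (Fin.append x (0 : Fin z → R)) = eGen univ x := by
  unfold eGen
  rw [Fin.prod_trunc]
  · simp only [Fin.append_left]
  · intro j
    simp

/-- `e_r(x_1, …, x_b, 0, …, 0) = e_r(x_1, …, x_b)`. [cite: Macdonald1995, Ch. I §2 (2.2)] -/
theorem esymm_append_zero (x : Fin b → R) (r : ℕ) :
    esymm (Fin.append x (0 : Fin z → R)) r = esymm x r := by
  rw [esymm_eq_coeff_eGen, esymm_eq_coeff_eGen, eGen_append_zero]

/-! ### Schur polynomials of a zero-padded alphabet -/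

/-- `(λ + 1_S)|_b = λ|_b + 1_{S'}` for `S = S'` pushed into the first `b` letters. [folklore] -/
private theorem castAdd_addOn_map (S : Finset (Fin b)) (μ : Fin (b + z) → ℕ) :
    (fun i : Fin b => addOn (S.map (Fin.castAddEmb z)) μ (Fin.castAdd z i)) =
      addOn S (fun i : Fin b => μ (Fin.castAdd z i)) := by
  funext i
  have : Fin.castAdd z i ∈ S.map (Fin.castAddEmb z) ↔ i ∈ S := by
    rw [← Fin.castAddEmb_apply, Finset.mem_map' (Fin.castAddEmb z)]
  simp only [addOn_apply, this]

/-- `λ + 1_S` still vanishes beyond `b` when `S` lies in the first `b` letters. [folklore] -/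
private theorem addOn_map_natAdd (S : Finset (Fin b)) (μ : Fin (b + z) → ℕ) (j : Fin z) :
    addOn (S.map (Fin.castAddEmb z)) μ (Fin.natAdd b j) = μ (Fin.natAdd b j) := by
  have : Fin.natAdd b j ∉ S.map (Fin.castAddEmb z) := by
    intro h
    obtain ⟨i, -, hi⟩ := Finset.mem_map.mp h
    have := congrArg Fin.val hi
    simp at this
    omega
  simp only [addOn_apply, this, if_false, add_zero]

/-- A subset of `Fin (b + z)` not coming from the first `b` letters contains one of the last `z`.
[folklore] -/
private theorem exists_natAdd_mem {S : Finset (Fin (b + z))}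
    (hS : S ∉ (Finset.univ : Finset (Finset (Fin b))).map (mapEmbedding (Fin.castAddEmb z)).toEmbedding) :
    ∃ j : Fin z, Fin.natAdd b j ∈ S := by
  by_contra hcon
  simp only [not_exists] at hcon
  apply hS
  rw [Finset.mem_map]
  refine ⟨S.preimage (Fin.castAdd z) (Fin.castAdd_injective _ _ |>.injOn), mem_univ _, ?_⟩
  change Finset.map (Fin.castAddEmb z) _ = S
  ext I
  rw [Finset.mem_map]
  constructor
  · rintro ⟨i, hi, rfl⟩
    rw [Finset.mem_preimage] at hi
    exact hi
  · intro hI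
    refine Fin.addCases (fun i hi => ⟨i, Finset.mem_preimage.mpr hi, rfl⟩) (fun j hj => ?_) I hI
    exact absurd hj (hcon j)

/-- **Schur polynomials of a zero-padded alphabet** (Macdonald 1995, Ch. I §3: `s_λ(x_1, …, x_n)
= 0` unless `l(λ) ≤ n` (3.2), and `s_λ(x_1, …, x_b, 0, …, 0) = s_λ(x_1, …, x_b)`): for antitone
`λ ∈ ℕ^{b+z}` and `x' = (x_1, …, x_b, 0, …, 0)`, `s_λ(x') = s_{λ|_b}(x)` if `λ` vanishes on the
last `z` letters, and `0` otherwise. Proof through Shintani's uniqueness theorem for the dual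
Pieri recursion (`eq_schur_smul_of_pieri`), the dual Pieri rule in `b` letters and
`e_r(x') = e_r(x)`. [cite: Macdonald1995, Ch. I §3 (3.2)] -/
theorem schur_append_zero (x : Fin b → R) {μ : Fin (b + z) → ℕ} (hμ : Antitone μ) :
    schur (Fin.append x (0 : Fin z → R)) μ =
      if ∀ j : Fin z, μ (Fin.natAdd b j) = 0 then schur x (fun i : Fin b => μ (Fin.castAdd z i))
      else 0 := by
  classical
  -- the candidate solution of the dual Pieri recursion
  set w : (Fin (b + z) → ℕ) → R := fun ν =>
    if Antitone ν ∧ ∀ j : Fin z, ν (Fin.natAdd b j) = 0 then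
      schur x (fun i : Fin b => ν (Fin.castAdd z i)) else 0 with hw
  have h0 : ∀ ν, ¬ Antitone ν → w ν = 0 := fun ν hν => by
    simp only [hw]
    rw [if_neg (fun h => hν h.1)]
  have hrec : ∀ la, Antitone la → ∀ r, 1 ≤ r → r ≤ b + z →
      esymm (Fin.append x (0 : Fin z → R)) r • w la =
        ∑ S ∈ powersetCard r univ, w (addOn S la) := by
    intro la hla r _ _
    rw [smul_eq_mul, esymm_append_zero]
    by_cases hv : ∀ j : Fin z, la (Fin.natAdd b j) = 0
    · -- `la` vanishes beyond `b`: dual Pieri in `b` letters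
      have hwla : w la = schur x (fun i : Fin b => la (Fin.castAdd z i)) := by
        simp only [hw]; rw [if_pos ⟨hla, hv⟩]
      rw [hwla, esymm_mul_schur, ← Finset.sum_subset (Finset.powersetCard_mono (Finset.subset_univ
          ((univ : Finset (Fin b)).map (Fin.castAddEmb z)))), Finset.powersetCard_map,
        Finset.sum_map]
      · refine Finset.sum_congr rfl fun S _ => ?_
        change schur x (addOn S _) = w (addOn (S.map (Fin.castAddEmb z)) la)
        have hv' : ∀ j : Fin z, addOn (S.map (Fin.castAddEmb z)) la (Fin.natAdd b j) = 0 :=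
          fun j => by rw [addOn_map_natAdd, hv j]
        simp only [hw]
        by_cases han : Antitone (addOn (S.map (Fin.castAddEmb z)) la)
        · rw [if_pos ⟨han, hv'⟩, castAdd_addOn_map]
        · rw [if_neg (fun h => han h.1)]
          refine schur_addOn_eq_zero x (antitone_castAdd hla) fun han' => han ?_
          refine antitone_of_antitone_castAdd hv' ?_
          rw [castAdd_addOn_map]
          exact han'
      · intro S _ hS
        rw [Finset.powersetCard_map] at hS
        have hS' : S ∉ (Finset.univ : Finset (Finset (Fin b))).map
            (mapEmbedding (Fin.castAddEmb z)).toEmbedding := fun h => hS (by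
          rw [Finset.mem_map] at h ⊢
          obtain ⟨S', -, hS'⟩ := h
          have hmem : S ∈ powersetCard r univ := by assumption
          refine ⟨S', ?_, hS'⟩
          rw [Finset.mem_powersetCard]
          refine ⟨Finset.subset_univ _, ?_⟩
          rw [← (Finset.mem_powersetCard.mp hmem).2, ← hS']
          exact (Finset.card_map _).symm)
        obtain ⟨j, hj⟩ := exists_natAdd_mem hS'
        simp only [hw]
        rw [if_neg]
        rintro ⟨-, h⟩
        have := h j
        rw [addOn_apply, if_pos hj] at this
        omega
    · -- `la` does not vanish beyond `b`: everything is `0`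
      have hwla : w la = 0 := by simp only [hw]; rw [if_neg (fun h => hv h.2)]
      rw [hwla, mul_zero]
      symm
      refine Finset.sum_eq_zero fun S _ => ?_
      simp only [hw]
      rw [if_neg]
      rintro ⟨-, h⟩
      apply hv
      intro j
      have := h j
      rw [addOn_apply] at this
      omega
  have key := eq_schur_smul_of_pieri (Fin.append x (0 : Fin z → R)) w h0 hrec hμ
  have hw0 : w 0 = 1 := by
    simp only [hw]
    rw [if_pos ⟨antitone_const, fun j => rfl⟩]
    exact schur_zero x
  rw [hw0, smul_eq_mul, mul_one] at key
  rw [← key]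
  simp only [hw]
  by_cases hv : ∀ j : Fin z, μ (Fin.natAdd b j) = 0
  · rw [if_pos ⟨hμ, hv⟩, if_pos hv]
  · rw [if_neg (fun h => hv h.2), if_neg hv]

/-! ### Cauchy's identity for alphabets of different sizes -/

/-- The geometric series of `0` is `1`. [folklore] -/
private theorem geom_zero : geom (0 : R) = 1 := by
  ext m
  rcases m with _ | m
  · simp
  · simp [pow_succ]

/-- **Cauchy's identity for alphabets of sizes `b` and `b + z`, degree by degree**: for
`x ∈ R^b`, `y ∈ R^{b+z}`, `h_D(x ⊗ y) = ∑_{M : [b] × [b+z] → ℕ, |M| = D} ∏ (x_i y_j)^{M_{ij}} =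
∑_{α ∈ ℕ^b antitone, |α| = D} s_α(x) s_{(α, 0, …, 0)}(y)` (only `l(α) ≤ b` contribute; the square
case applied to the zero-padded `x`). [cite: Macdonald1995, Ch. I §4 (4.3)] -/
theorem sum_piAntidiag_prod_pow_eq_sum_schur_mul_schur_append (x : Fin b → R)
    (y : Fin (b + z) → R) (D : ℕ) :
    ∑ M ∈ piAntidiag (univ : Finset (Fin b × Fin (b + z))) D, ∏ q, (x q.1 * y q.2) ^ M q =
      ∑ α ∈ antitoneWeights b D,
        schur x α * schur y (Fin.append α (0 : Fin z → ℕ)) := by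
  -- the product of geometric series does not see the padded zeros
  have hprod : ∏ i : Fin (b + z), ∏ j, geom (Fin.append x (0 : Fin z → R) i * y j) =
      ∏ q : Fin b × Fin (b + z), geom (x q.1 * y q.2) := by
    rw [Fintype.prod_prod_type, Fin.prod_trunc]
    · simp only [Fin.append_left]
    · intro j
      simp [geom_zero]
  rw [← coeff_prod_geom', ← hprod, ← cauchySeries_eq_prod_geom, cauchySeries, PowerSeries.coeff_mk]
  -- only the weights vanishing beyond `b` contribute
  have hterm : ∀ α ∈ antitoneWeights (b + z) D,
      schur (Fin.append x (0 : Fin z → R)) α * schur y α =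
        if ∀ j : Fin z, α (Fin.natAdd b j) = 0 then
          schur x (fun i : Fin b => α (Fin.castAdd z i)) * schur y α else 0 := by
    intro α hα
    rw [schur_append_zero x (mem_antitoneWeights.1 hα).2]
    split_ifs <;> simp
  rw [Finset.sum_congr rfl hterm, ← Finset.sum_filter]
  refine Finset.sum_nbij' (fun α => fun i : Fin b => α (Fin.castAdd z i))
    (fun α => Fin.append α (0 : Fin z → ℕ)) ?_ ?_ ?_ ?_ ?_
  · intro α hα
    rw [Finset.mem_filter, mem_antitoneWeights] at hα
    rw [mem_antitoneWeights]
    refine ⟨?_, antitone_castAdd hα.1.2⟩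
    rw [← hα.1.1, ← sum_append_zero _ z, append_castAdd_eq hα.2]
  · intro α hα
    rw [mem_antitoneWeights] at hα
    rw [Finset.mem_filter, mem_antitoneWeights]
    exact ⟨⟨by rw [sum_append_zero, hα.1], antitone_append_zero hα.2 z⟩, fun j => by simp⟩
  · intro α hα
    rw [Finset.mem_filter] at hα
    exact append_castAdd_eq hα.2
  · intro α _
    funext i
    simp
  · intro α hα
    rw [Finset.mem_filter] at hα
    rw [append_castAdd_eq hα.2]

end Literature.RingTheory.SymmetricFunctions.SymmPoly
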